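import Literature.Barriers.CriticalPhenomena.RigorousRGSmallParameterRGNorms
import HarnessLib

/-!
# `RigorousRGSmallParameter` (Slade, Theorem 1.4.1): change of scale in the norms of Slade §6.2 —
# monotonicity of the field norms, nesting of blocks and small-set neighbourhoods, and
# Slade's Lemma 6.4.1 `G_j(X,φ)^t ≤ G_{j+1}(X,φ)`

Companion ("proof architecture") file of
`Literature/Barriers/CriticalPhenomena/RigorousRGSmallParameter.lean`, on top of
`…RGNorms` (field norm (6.29), local norms (6.30), regulators (6.32)) and `…Polymers` (blocks,
small sets, small-set neighbourhoods `X^□`). Slade's Theorem 6.3.1 — the renormalisation-group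
step whose output is the named fact `LongRangePhi4.Slade2017_prop822` — is proved in his §9 from
[BS-rg-step] after the adaptation of the norm estimates of §6.4; the first of these, Lemma 6.4.1,
is the comparison of the fluctuation-field regulators at consecutive scales used for the
simplified `𝒲`-norm above the mass scale ("a simplification for scales above the mass scale
`j_m`"). This file PROVES it for the concrete model (fields `φ : Λ_N → ℝⁿ` on the torus
`TorusSite d M`), together with the elementary change-of-scale facts its two-line printed proof
uses. Source: G. Slade, Commun. Math. Phys. 358 (2018), arXiv:1611.06169, §6.4.2, Lemma 6.4.1 and
its proof (read from the TeX source: "`‖φ‖_{Φ_j(ℓ_j)} ≤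
ℓ_j⁻¹ℓ_{j+1}‖φ‖_{Φ'_{j}(ℓ_{j+1})} ≤ L^{-(d+α')/2}‖φ‖_{Φ_{j+1}(ℓ_{j+1})}` … since
`‖φ‖_{Φ_j(b^□)} ≤ ‖φ‖_{Φ_j(B^□)}` … it suffices if `tL^{-α'} ≤ 1`").

## What this file provides (theorems; no definition of a norm is changed, no named fact)

* `fieldNorm_le_scale`: **`‖φ‖_{Φ(𝔥,R)} ≤ (𝔥'/𝔥)‖φ‖_{Φ(𝔥',R')}`** for `0 ≤ R ≤ R'`, `𝔥, 𝔥' > 0`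
  (monotonicity in the derivative weight `R = L^j` and the `𝔥`-scaling of (6.29));
  `localFieldNorm_le_scale`: the same for the local norms (6.30), monotone in the set `X ⊆ X'`.
* `block_subset_block_mul` (**`B_b(x) ⊆ B_{bc}(x)`**: `j`-blocks are nested in `(j+1)`-blocks,
  `L^{j+1} = L^j·L`), `coarsen` (the union of the `(bc)`-blocks of a set) with `subset_coarsen`,
  `isPolymer_coarsen`, `isConn_coarsen`, `numBlocks_coarsen_le`, `isSmall_coarsen` (a scale-`j`
  small set coarsens to a scale-`(j+1)` small set), and **`sclosure_subset_sclosure_mul`**: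
  `X^{□,j} ⊆ X^{□,j+1}`, whence `b^{□} ⊆ B^{□}` for `b ⊆ B`.
* `Slade2017_lem641`: **Lemma 6.4.1** — if `t(ℓ'/ℓ)²L^d ≤ 1` then
  `G(b,ℓ,R; X,φ)^t ≤ G(bL,ℓ',R'; X,φ)` for all `X`, `φ` (`b = L^j`, `R = L^j ≤ R' = L^{j+1}`,
  `ℓ = ℓ_j`, `ℓ' = ℓ_{j+1}`; with Slade's `ℓ_j⁻¹ℓ_{j+1} = L^{-(d+α')/2}` above the mass scale the
  hypothesis reads `tL^{-α'} ≤ 1`, his "for `L` sufficiently large"). The statement is kept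
  parametric in `(b, L, ℓ, ℓ', R, R', t)` so that it applies verbatim to Slade's sequences
  (6.26)–(6.27); the arithmetic of `ℓ_j` is not repeated here.

## References

* [Slade2017] G. Slade, *Critical exponents for long-range O(n) models below the upper critical
  dimension*, Commun. Math. Phys. 358 (2018) 343–436, arXiv:1611.06169 — §6.2 (norms,
  regulators), §6.4.2 Lemma 6.4.1.
* [BrydgesSlade2015RGI] D. C. Brydges, G. Slade, *A renormalisation group method. I. Gaussian
  integration and normed algebras*, J. Stat. Phys. 159 (2015) 421–460, arXiv:1403.7244 — §3.5
  (field norms), §3.7 (regulators).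
-/

noncomputable section

namespace Literature.Barriers.CriticalPhenomena

namespace LongRangePhi4

namespace RGNorm

open Finset Tphi Polymer Literature.Probability.LatticeModels
open scoped ContDiff

variable {d M n : ℕ} [NeZero M]

/-! ### Monotonicity of the field norm (6.29) in `R` and scaling in `𝔥` -/

/-- **`‖φ‖_{Φ(𝔥,R)} ≤ (𝔥'/𝔥)‖φ‖_{Φ(𝔥',R')}` for `R ≤ R'`**: enlarging the derivative weight `R = L^j`
("replacement of `L^{j|a|}` … by `L^{(j+1)|a|}`") and rescaling `𝔥` (`ℓ_j⁻¹ℓ_{j+1}`), as in the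
proof of Lemma 6.4.1. [cite: Slade2017, Lemma 6.4.1 (proof, displays (6.43)–(6.44))] -/
theorem fieldNorm_le_scale {𝔥 𝔥' R R' : ℝ} (h𝔥 : 0 < 𝔥) (h𝔥' : 0 < 𝔥') (hR : 0 ≤ R) (hRR' : R ≤ R')
    (pΦ : ℕ) (φ : TorusSite d M → Fin n → ℝ) [Nonempty (Fin n)] :
    fieldNorm 𝔥 R pΦ φ ≤ (𝔥' / 𝔥) * fieldNorm 𝔥' R' pΦ φ := by
  refine csSup_le ?_ ?_
  · obtain ⟨i⟩ := ‹Nonempty (Fin n)›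
    exact ⟨_, ⟨((fun _ => 0), i), [], Nat.zero_le _, rfl⟩⟩
  · rintro _ ⟨p, l, hl, rfl⟩
    have h := le_fieldNorm (𝔥 := 𝔥') (R := R') φ p hl
    have hpow : R ^ l.length ≤ R' ^ l.length := pow_le_pow_left₀ hR hRR' _
    have hnn : 0 ≤ |napply (unitStep d M) (prog1 l) (liftFn (fieldFn φ)) [p]| := abs_nonneg _
    calc 𝔥⁻¹ * R ^ l.length * |napply (unitStep d M) (prog1 l) (liftFn (fieldFn φ)) [p]|
        ≤ 𝔥⁻¹ * R' ^ l.length * |napply (unitStep d M) (prog1 l) (liftFn (fieldFn φ)) [p]| := by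
          gcongr
      _ = (𝔥' / 𝔥) * (𝔥'⁻¹ * R' ^ l.length * |napply (unitStep d M) (prog1 l) (liftFn (fieldFn φ)) [p]|) := by
          field_simp
      _ ≤ (𝔥' / 𝔥) * fieldNorm 𝔥' R' pΦ φ := mul_le_mul_of_nonneg_left h (by positivity)

/-- **The local norm (6.30) is monotone in the set and inherits the scaling**:
`‖φ‖_{Φ(X;𝔥,R)} ≤ (𝔥'/𝔥)‖φ‖_{Φ(X';𝔥',R')}` for `X ⊆ X'`, `R ≤ R'` ("since
`‖φ‖_{Φ_j(b^□)} ≤ ‖φ‖_{Φ_j(B^□)}` by definition"). [cite: Slade2017, Lemma 6.4.1 (proof)] -/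
theorem localFieldNorm_le_scale {𝔥 𝔥' R R' : ℝ} (h𝔥 : 0 < 𝔥) (h𝔥' : 0 < 𝔥') (hR : 0 ≤ R) (hRR' : R ≤ R')
    (pΦ : ℕ) {X X' : Finset (TorusSite d M)} (hXX' : X ⊆ X') (φ : TorusSite d M → Fin n → ℝ) [Nonempty (Fin n)] :
    localFieldNorm 𝔥 R pΦ X φ ≤ (𝔥' / 𝔥) * localFieldNorm 𝔥' R' pΦ X' φ := by
  have hc : 0 < 𝔥' / 𝔥 := div_pos h𝔥' h𝔥
  unfold localFieldNorm
  -- every competitor for `X'` is a competitor for `X`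
  have hne : ((fieldNorm 𝔥' R' pΦ) '' {ψ : TorusSite d M → Fin n → ℝ | ∀ x ∈ X', ψ x = φ x}).Nonempty :=
    ⟨_, ⟨φ, fun _ _ => rfl, rfl⟩⟩
  have hbdd : BddBelow ((fieldNorm 𝔥 R pΦ) '' {ψ : TorusSite d M → Fin n → ℝ | ∀ x ∈ X, ψ x = φ x}) :=
    ⟨0, by rintro _ ⟨ψ, _, rfl⟩; exact fieldNorm_nonneg h𝔥.le pΦ ψ⟩
  rw [← div_le_iff₀' hc]
  refine le_csInf hne ?_
  rintro _ ⟨ψ, hψ, rfl⟩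
  rw [div_le_iff₀' hc]
  exact (csInf_le hbdd ⟨ψ, fun x hx => hψ x (hXX' hx), rfl⟩).trans (fieldNorm_le_scale h𝔥 h𝔥' hR hRR' pΦ ψ)

/-! ### Nesting of blocks and of small-set neighbourhoods across scales -/

/-- **Blocks are nested**: the `b`-block of `x` is contained in its `(bc)`-block (each `j`-block
lies in one `(j+1)`-block, `L^{j+1} = L^j L`). [cite: Slade2017, §6.1 (Figure: the hierarchy of blocks)] -/
theorem block_subset_block_mul (b c : ℕ) (x : TorusSite d M) : block b x ⊆ block (b * c) x := by
  intro y hy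
  rw [mem_block] at hy ⊢
  funext i
  have := congrFun hy i
  simp only [blockKey] at this ⊢
  rw [← Nat.div_div_eq_div_mul, ← Nat.div_div_eq_div_mul, this]

/-- Coarser blocks are determined by finer ones. [folklore] -/
theorem block_mul_eq_of_block_eq {b c : ℕ} {x y : TorusSite d M} (h : block b y = block b x) :
    block (b * c) y = block (b * c) x :=
  block_eq_of_mem (block_subset_block_mul b c x (block_eq_block_iff.1 h))

/-- The coarsening of a set: the union of the `(bc)`-blocks of its points. [folklore] -/
def coarsen (b c : ℕ) (Y : Finset (TorusSite d M)) : Finset (TorusSite d M) := Y.biUnion (block (b * c))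

/-- `Y ⊆ coarsen Y`. [folklore] -/
theorem subset_coarsen (b c : ℕ) (Y : Finset (TorusSite d M)) : Y ⊆ coarsen b c Y :=
  fun y hy => mem_biUnion.2 ⟨y, hy, mem_block_self _ y⟩

/-- The coarsening is a `(bc)`-polymer. [folklore] -/
theorem isPolymer_coarsen (b c : ℕ) (Y : Finset (TorusSite d M)) : IsPolymer (b * c) (coarsen b c Y) := by
  intro z hz
  obtain ⟨y, hy, hzy⟩ := mem_biUnion.1 hz
  rw [block_eq_of_mem hzy]
  exact fun w hw => mem_biUnion.2 ⟨y, hy, hw⟩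

/-- The coarsening of a connected set is connected. [folklore] -/
theorem isConn_coarsen (b c : ℕ) {Y : Finset (TorusSite d M)} (hY : IsConn Y) : IsConn (coarsen b c Y) := by
  refine ⟨⟨_, subset_coarsen b c Y hY.1.choose_spec⟩, fun z hz w hw => ?_⟩
  obtain ⟨y, hy, hzy⟩ := mem_biUnion.1 hz
  obtain ⟨y', hy', hwy'⟩ := mem_biUnion.1 hw
  have hsub : ∀ {u : TorusSite d M}, u ∈ Y → block (b * c) u ⊆ coarsen b c Y :=
    fun hu v hv => mem_biUnion.2 ⟨_, hu, hv⟩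
  -- `z → y` inside the block of `y`, `y → y'` inside `Y`, `y' → w` inside the block of `y'`
  have h1 : ConnIn (coarsen b c Y) z y := ((connIn_block hzy).mono (hsub hy)).symm
  have h2 : ConnIn (coarsen b c Y) y y' := (hY.2 y hy y' hy').mono (subset_coarsen b c Y)
  have h3 : ConnIn (coarsen b c Y) y' w := (connIn_block hwy').mono (hsub hy')
  exact h1.trans (h2.trans h3)

/-- All points of a `b`-block have the same `(bc)`-block: `⋃_{z ∈ B_b(y)} B_{bc}(z) = B_{bc}(y)`. [folklore] -/
theorem block_biUnion_block_mul (b c : ℕ) (y : TorusSite d M) :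
    (block b y).biUnion (block (b * c)) = block (b * c) y := by
  ext w
  simp only [mem_biUnion]
  constructor
  · rintro ⟨z, hz, hw⟩
    rwa [block_mul_eq_of_block_eq (block_eq_of_mem hz)] at hw
  · intro hw
    exact ⟨y, mem_block_self b y, hw⟩

/-- The coarsening has no more blocks than the original set: `|coarsen Y|_{bc} ≤ |Y|_b`. [folklore] -/
theorem numBlocks_coarsen_le (b c : ℕ) (Y : Finset (TorusSite d M)) :
    numBlocks (b * c) (coarsen b c Y) ≤ numBlocks b Y := by
  unfold numBlocks blocksOf
  have h1 : (coarsen b c Y).image (block (b * c)) = Y.image (block (b * c)) := by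
    ext B
    simp only [mem_image, coarsen, mem_biUnion]
    constructor
    · rintro ⟨z, ⟨y, hy, hzy⟩, rfl⟩
      exact ⟨y, hy, (block_eq_of_mem hzy).symm⟩
    · rintro ⟨y, hy, rfl⟩
      exact ⟨y, ⟨y, hy, mem_block_self _ y⟩, rfl⟩
  -- `block (b c)` factors through `block b`, without choice: `B ↦ ⋃_{z∈B} B_{bc}(z)`
  have h2 : Y.image (block (b * c)) = (Y.image (block b)).image (fun B => B.biUnion (block (b * c))) := by
    rw [Finset.image_image]
    refine Finset.image_congr fun y _ => ?_
    simp only [Function.comp_apply, block_biUnion_block_mul]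
  rw [h1, h2]
  exact Finset.card_image_le

/-- A small set at block side `b` coarsens to a small set at block side `bc`. [folklore] -/
theorem isSmall_coarsen (b c : ℕ) {Y : Finset (TorusSite d M)} (hY : IsSmall b Y) : IsSmall (b * c) (coarsen b c Y) :=
  ⟨isPolymer_coarsen b c Y, isConn_coarsen b c hY.2.1, (numBlocks_coarsen_le b c Y).trans hY.2.2⟩

/-- **Small-set neighbourhoods are nested across scales**: `X^{□,b} ⊆ X^{□,bc}` for every set `X`
(a scale-`j` small set meeting `X` coarsens to a scale-`(j+1)` small set meeting `X`). In
particular `b^{□,j} ⊆ B^{□,j+1}` for `b ⊆ B`, as used in the proof of Lemma 6.4.1.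
[cite: Slade2017, Lemma 6.4.1 (proof: "let b ∈ ℬ_j, and let B ∈ ℬ_{j+1} with b ⊂ B")] -/
theorem sclosure_subset_sclosure_mul (b c : ℕ) (X : Finset (TorusSite d M)) :
    sclosure b X ⊆ sclosure (b * c) X := by
  intro y hy
  obtain ⟨Y, hY, ⟨w, hw⟩, hyY⟩ := mem_sclosure.1 hy
  refine mem_sclosure.2 ⟨coarsen b c Y, isSmall_coarsen b c hY, ⟨w, ?_⟩, subset_coarsen b c Y hyY⟩
  rw [mem_inter] at hw ⊢
  exact ⟨hw.1, subset_coarsen b c Y hw.2⟩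

/-! ### Lemma 6.4.1: `G_j(X,φ)^t ≤ G_{j+1}(X,φ)` -/

/-- **Slade, Lemma 6.4.1 (simplified `𝒲`-norm above the mass scale).** With block sides
`b = L^j`, `b' = bL = L^{j+1}`, derivative weights `R ≤ R'` (`L^j ≤ L^{j+1}`) and field scales
`ℓ = ℓ_j`, `ℓ' = ℓ_{j+1}`: if `t (ℓ'/ℓ)² L^d ≤ 1` ("`L` large enough that `tL^{-α'} ≤ 1`", since
`ℓ_j⁻¹ℓ_{j+1} = L^{-½(d+α')}` above the mass scale), then `G_j(X,φ)^t ≤ G_{j+1}(X,φ)` for every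
`X ⊆ Λ` and every field `φ`. Proof as printed: `‖φ‖_{Φ_j(B_x^{□,j},ℓ_j)} ≤ (ℓ_{j+1}/ℓ_j)‖φ‖_{Φ_{j+1}(B_x^{□,j+1},ℓ_{j+1})}`
(monotonicity in the set, `b^□ ⊆ B^□`, in `R`, and the `𝔥`-scaling), then
`tL^{-dj}(·)² ≤ L^{-d(j+1)}(·)²`. [cite: Slade2017, Lemma 6.4.1] -/
theorem Slade2017_lem641 {L b : ℕ} (hL : 1 ≤ L) (hb : 1 ≤ b) {ℓ ℓ' R R' t : ℝ} (hℓ : 0 < ℓ) (hℓ' : 0 < ℓ')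
    (hR : 0 ≤ R) (hRR' : R ≤ R') (ht : 0 ≤ t) (hsmall : t * (ℓ' / ℓ) ^ 2 * (L : ℝ) ^ d ≤ 1) (pΦ : ℕ)
    (X : Finset (TorusSite d M)) (φ : TorusSite d M → Fin n → ℝ) [Nonempty (Fin n)] :
    fluctReg b ℓ R pΦ X φ ^ t ≤ fluctReg (b * L) ℓ' R' pΦ X φ := by
  have hb0 : ((b : ℝ) ^ d) ≠ 0 := by positivity
  have hL0 : ((L : ℝ) ^ d) ≠ 0 := by positivity
  have hℓ0 : ℓ ≠ 0 := hℓ.ne'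
  unfold fluctReg
  rw [← Real.exp_mul, Real.exp_le_exp, Finset.sum_mul]
  refine Finset.sum_le_sum fun x _ => ?_
  -- `b^{□,j} ⊆ B^{□,j+1}` and the local norms compare with ratio `ℓ'/ℓ`
  have hsub : sclosure b (block b x) ⊆ sclosure (b * L) (block (b * L) x) :=
    (sclosure_subset_sclosure_mul b L (block b x)).trans (sclosure_mono _ (block_subset_block_mul b L x))
  have hcmp := localFieldNorm_le_scale hℓ hℓ' hR hRR' pΦ hsub φ
  have ha : 0 ≤ localFieldNorm ℓ R pΦ (sclosure b (block b x)) φ := localFieldNorm_nonneg hℓ.le pΦ _ φ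
  have hsq : localFieldNorm ℓ R pΦ (sclosure b (block b x)) φ ^ 2 ≤
      (ℓ' / ℓ) ^ 2 * localFieldNorm ℓ' R' pΦ (sclosure (b * L) (block (b * L) x)) φ ^ 2 := by
    rw [← mul_pow]; exact pow_le_pow_left₀ ha hcmp 2
  have hcast : (((b * L : ℕ) : ℝ) ^ d)⁻¹ = ((b : ℝ) ^ d)⁻¹ * ((L : ℝ) ^ d)⁻¹ := by
    push_cast; rw [mul_pow, mul_inv]
  rw [hcast]
  calc ((b : ℝ) ^ d)⁻¹ * localFieldNorm ℓ R pΦ (sclosure b (block b x)) φ ^ 2 * t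
      ≤ ((b : ℝ) ^ d)⁻¹ * ((ℓ' / ℓ) ^ 2 * localFieldNorm ℓ' R' pΦ (sclosure (b * L) (block (b * L) x)) φ ^ 2) * t :=
        mul_le_mul_of_nonneg_right (mul_le_mul_of_nonneg_left hsq (by positivity)) ht
    _ = (t * (ℓ' / ℓ) ^ 2 * (L : ℝ) ^ d) *
          (((b : ℝ) ^ d)⁻¹ * ((L : ℝ) ^ d)⁻¹ * localFieldNorm ℓ' R' pΦ (sclosure (b * L) (block (b * L) x)) φ ^ 2) := by
        field_simp
    _ ≤ 1 * (((b : ℝ) ^ d)⁻¹ * ((L : ℝ) ^ d)⁻¹ * localFieldNorm ℓ' R' pΦ (sclosure (b * L) (block (b * L) x)) φ ^ 2) :=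
        mul_le_mul_of_nonneg_right hsmall
          (mul_nonneg (mul_nonneg (inv_nonneg.2 (pow_nonneg (Nat.cast_nonneg _) _))
            (inv_nonneg.2 (pow_nonneg (Nat.cast_nonneg _) _))) (sq_nonneg _))
    _ = _ := one_mul _

end RGNorm

end LongRangePhi4

end Literature.Barriers.CriticalPhenomena

end
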